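import Summits.AtomisticToContinuum.FouriersLaw.Theorems.BondHeatUncertaintyBoundedResponseBathHeatB

/-!
# BondHeatUncertainty / BoundedResponse — «BathHeat», part C: §2 the bath side (`bathKinCorr`, `bathHeatVar = E[(Q^L_t)²]`, `W_N ≥ 0`)
(lens-1 g107 NODE 107 `…BathHeat.lean` sha256 128247e61f0c3dd6…, 1464 l, cut at section boundaries under the 400-line cap by hand-2 g39 for landing: A = §0 (l.1–266),
B = §1 (l.268–492), C = §2 (l.494–617), D = §3 (l.619–867), E = §4 (l.869–1214), main = §5 (l.1216–1462); bodies byte-verbatim, header l.92–107 repeated; full module docstring in part A.) -/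

noncomputable section

open MeasureTheory ProbabilityTheory Filter Topology Set Function
open scoped NNReal ENNReal
open Literature.MathematicalPhysics.KineticTheory.HeatConduction
open Literature.MathematicalPhysics.KineticTheory OscillatorChain
open Literature.Probability.Process
open Summit.AtomisticToContinuum.FouriersLaw.Theorems.SubdiffusiveBondHeat
open Summit.AtomisticToContinuum.FouriersLaw.Theorems.SubdiffusiveBondHeat.EscapeGrading
open Summit.AtomisticToContinuum.FouriersLaw.Theorems.OddSectorIrreversibility

namespace Summit.AtomisticToContinuum.FouriersLaw.Theorems.BoundedResponse.HeatSpreading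

open Summit.AtomisticToContinuum.FouriersLaw.Theorems.BoundedResponse.TransientContact
open Summit.AtomisticToContinuum.FouriersLaw.Theorems.BoundedResponse.ParityFloor (extensiveBlockEnergyVariance_holds)
open Summit.AtomisticToContinuum.FouriersLaw.Theses.BondHeatUncertainty (BoundedResponse SubdiffusiveBondHeat)

/-! ## §2 The bath side of the blocker: `K_N`, the bath heat variance `W_N(t) = E[(Q^L_t)²]`, `W_N ≥ 0` -/

/-- **`K_N(u) = ⟪p₀² − T, P_u (p₀² − T)⟫_T`** — the bath kinetic autocorrelation, VERBATIM the integrand of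
`EscapeGrading.escapeDeficit` (`E_N = 1 − (γ/T²)∫₀^∞ K_N`), so that every statement below is about the blocker's own datum.
[formal bookkeeping] -/
def bathKinCorr (ω₂ lam β γ T : ℝ) (N : ℕ) (u : ℝ) : ℝ :=
  if h : 0 < N then
    ∫ z, ((z.2 ⟨0, h⟩) ^ 2 - T) *
        (∫ y, ((y.2 ⟨0, h⟩) ^ 2 - T) ∂((pinnedChain ω₂ lam β γ).transitionKernel N T T u.toNNReal z))
      ∂((pinnedChain ω₂ lam β γ).gibbsMeasure N T)
  else 0

/-- `E_N = 1 − (γ/T²) ∫_{(0,∞)} K_N` (definitional). [formal bookkeeping] -/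
theorem escapeDeficit_eq_bathKinCorr (ω₂ lam β γ T : ℝ) (N : ℕ) :
    escapeDeficit ω₂ lam β γ T N = 1 - γ / T ^ 2 * ∫ u in Ioi (0 : ℝ), bathKinCorr ω₂ lam β γ T N u := rfl

/-- **The BATH HEAT VARIANCE functional `W_N(t) := 2γT²·t − 2γ² ∫₀ᵗ (t − r) K_N(r) dr`** — by `pinnedChain_bathHeat_sq_eq` it IS
the second moment of the left-bath heat proxy `Q^L_t = ∫₀ᵗ j₀ + e₀(z_t) − e₀(z_0)` in equilibrium; `2γT²t` is the white bath-noise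
(martingale) part, the `K_N` term the kinetic feedback.  [formal bookkeeping; the identity is the theorem] -/
def bathHeatVar (ω₂ lam β γ T : ℝ) (N : ℕ) (t : ℝ) : ℝ :=
  2 * γ * T ^ 2 * t - 2 * γ ^ 2 * ∫ r in (0 : ℝ)..t, (t - r) * bathKinCorr ω₂ lam β γ T N r

section BathSide

variable {ω₂ lam β γ : ℝ} (hω : 0 < ω₂) (hl : 0 < lam) (hβ : 0 < β) (hγ : 0 < γ) {N : ℕ} (hN : 1 < N)
  {T : ℝ} (hT : 0 < T)
include hω hl hβ hγ hN hT

omit hω hl hβ hγ hT in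
/-- `⟪γ(T − p₀²), P_r γ(T − p₀²)⟫_T = γ² K_N(r)`. [formal bookkeeping] -/
theorem kpair_bathDrift_eq (r : ℝ) :
    kpair ω₂ lam β γ T N (fun y => γ * (T - (y.2 ⟨0, Nat.zero_lt_of_lt hN⟩) ^ 2))
        (fun y => γ * (T - (y.2 ⟨0, Nat.zero_lt_of_lt hN⟩) ^ 2)) r = γ ^ 2 * bathKinCorr ω₂ lam β γ T N r := by
  simp only [kpair, bathKinCorr, dif_pos (Nat.zero_lt_of_lt hN)]
  rw [← MeasureTheory.integral_const_mul]
  refine integral_congr_ae (Eventually.of_forall fun z => ?_)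
  have h : ∀ y : PhaseSpace N, γ * (T - (y.2 ⟨0, Nat.zero_lt_of_lt hN⟩) ^ 2) = (-γ) * ((y.2 ⟨0, Nat.zero_lt_of_lt hN⟩) ^ 2 - T) :=
    fun y => by ring
  simp_rw [h]
  rw [MeasureTheory.integral_const_mul]
  ring

/-- **The static input, with EQUALITY**: `⟪e₀, j₀ − γ(T − p₀²)⟫_T = γT²` (`⟨e₀ j₀⟩ = 0` by parity, Gaussian integration by parts,
`⟨p₀⁴⟩ = 3T²`; tree: `pinnedChain_integral_siteEnergy_mul_deficit_mul_gibbsDensity`). [folklore] -/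
theorem spair_siteEnergy_deficit_eq :
    spair ω₂ lam β γ T N
        (fun y => (y.2 ⟨0, Nat.zero_lt_of_lt hN⟩) ^ 2 / 2 + (pinnedChain ω₂ lam β γ).U (y.1 ⟨0, Nat.zero_lt_of_lt hN⟩) +
          (pinnedChain ω₂ lam β γ).V (y.1 ⟨1, hN⟩ - y.1 ⟨0, Nat.zero_lt_of_lt hN⟩) / 2)
        (fun y => (pinnedChain ω₂ lam β γ).bondCurrent N ⟨0, Nat.zero_lt_of_lt hN⟩ y -
          γ * (T - (y.2 ⟨0, Nat.zero_lt_of_lt hN⟩) ^ 2)) = γ * T ^ 2 := by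
  simp only [spair]
  rw [(pinnedChain ω₂ lam β γ).integral_gibbsMeasure,
    pinnedChain_integral_siteEnergy_mul_deficit_mul_gibbsDensity hω hl.le hβ.le γ N hT
      (i := ⟨0, Nat.zero_lt_of_lt hN⟩) (j := ⟨1, hN⟩) rfl γ]
  have hZ : 0 < ∫ x, (pinnedChain ω₂ lam β γ).gibbsDensity N T x :=
    integral_exp_pos (pinnedChain_integrable_gibbsDensity hω hl.le hβ.le γ N hT)
  field_simp

/-- ★ **THE BATH-SIDE EINSTEIN–HELFAND IDENTITY** (`N ≥ 2`, `t ≥ 0`): along the stationary constructed flow started from `μ_T`,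
the left-bath HEAT PROXY `Q^L_t := ∫₀ᵗ j₀(z_s) ds + e₀(z_t) − e₀(z_0)` (site-`0` energy balance: `Q^L_t` = heat absorbed from the
left bath on `[0,t]`) has second moment EXACTLY
`E[(Q^L_t)²] = W_N(t) = 2γT²·t − 2γ² ∫₀ᵗ (t − r) K_N(r) dr`,
with `K_N` the kinetic kernel of `escapeDeficit` (the blocker's datum).  Instance of `pinnedChain_heatProxy_sq_eq` with the tree's
site-energy Dynkin identity (`stub_siteEnergyDynkin`), the static covariance with equality, and `⟪γ(T−p₀²),Pγ(T−p₀²)⟫ = γ²K_N`.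
NEW as a typed statement. [folklore mechanism (Kundu–Dhar–Narayan open-system Green–Kubo); this cell] -/
theorem pinnedChain_bathHeat_sq_eq {t : ℝ} (ht : 0 ≤ t) :
    ∫ p, ((∫ s in (0 : ℝ)..t, (pinnedChain ω₂ lam β γ).bondCurrent N ⟨0, Nat.zero_lt_of_lt hN⟩
          ((pinnedChain ω₂ lam β γ).solMap N T T s p.1 (pairPath p.2))) +
        (((((pinnedChain ω₂ lam β γ).solMap N T T t p.1 (pairPath p.2)).2 ⟨0, Nat.zero_lt_of_lt hN⟩) ^ 2 / 2 +
            (pinnedChain ω₂ lam β γ).U (((pinnedChain ω₂ lam β γ).solMap N T T t p.1 (pairPath p.2)).1 ⟨0, Nat.zero_lt_of_lt hN⟩) +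
            (pinnedChain ω₂ lam β γ).V (((pinnedChain ω₂ lam β γ).solMap N T T t p.1 (pairPath p.2)).1 ⟨1, hN⟩ -
              ((pinnedChain ω₂ lam β γ).solMap N T T t p.1 (pairPath p.2)).1 ⟨0, Nat.zero_lt_of_lt hN⟩) / 2) -
          ((p.1.2 ⟨0, Nat.zero_lt_of_lt hN⟩) ^ 2 / 2 + (pinnedChain ω₂ lam β γ).U (p.1.1 ⟨0, Nat.zero_lt_of_lt hN⟩) +
            (pinnedChain ω₂ lam β γ).V (p.1.1 ⟨1, hN⟩ - p.1.1 ⟨0, Nat.zero_lt_of_lt hN⟩) / 2))) ^ 2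
      ∂(((pinnedChain ω₂ lam β γ).gibbsMeasure N T).prod wienerPair) =
      bathHeatVar ω₂ lam β γ T N t := by
  -- the three observables
  have hUc : Continuous (pinnedChain ω₂ lam β γ).U := (pinnedChain_contDiff_U ω₂ lam β γ (n := 0)).continuous
  have hVc : Continuous (pinnedChain ω₂ lam β γ).V := (pinnedChain_contDiff_V ω₂ lam β γ (n := 0)).continuous
  have hp0 : Continuous fun y : PhaseSpace N => y.2 ⟨0, Nat.zero_lt_of_lt hN⟩ := by fun_prop
  have hq0 : Continuous fun y : PhaseSpace N => y.1 ⟨0, Nat.zero_lt_of_lt hN⟩ := by fun_prop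
  have hq1 : Continuous fun y : PhaseSpace N => y.1 ⟨1, hN⟩ := by fun_prop
  have hjm : Measurable ((pinnedChain ω₂ lam β γ).bondCurrent N ⟨0, Nat.zero_lt_of_lt hN⟩) :=
    (pinnedChain_continuous_bondCurrent ω₂ lam β γ N _).measurable
  have hem : Measurable (fun y : PhaseSpace N => (y.2 ⟨0, Nat.zero_lt_of_lt hN⟩) ^ 2 / 2 +
      (pinnedChain ω₂ lam β γ).U (y.1 ⟨0, Nat.zero_lt_of_lt hN⟩) +
      (pinnedChain ω₂ lam β γ).V (y.1 ⟨1, hN⟩ - y.1 ⟨0, Nat.zero_lt_of_lt hN⟩) / 2) :=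
    ((((hp0.pow 2).div_const 2).add (hUc.comp hq0)).add ((hVc.comp (hq1.sub hq0)).div_const 2)).measurable
  have hφm : Measurable (fun y : PhaseSpace N => γ * (T - (y.2 ⟨0, Nat.zero_lt_of_lt hN⟩) ^ 2)) :=
    (continuous_const.mul (continuous_const.sub (hp0.pow 2))).measurable
  have hj2 := pinnedChain_integrable_sq_bondCurrent hω hl.le hβ.le γ N hT ⟨0, Nat.zero_lt_of_lt hN⟩
  have he2 := pinnedChain_integrable_sq_siteEnergy hω hl.le hβ.le γ N hT hN
  have hφ2 := pinnedChain_integrable_sq_kineticDeviation hω hl.le hβ.le γ N hT γ T ⟨0, Nat.zero_lt_of_lt hN⟩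
  have hjo : ∀ y : PhaseSpace N, (pinnedChain ω₂ lam β γ).bondCurrent N ⟨0, Nat.zero_lt_of_lt hN⟩ (y.1, -y.2) =
      -1 * (pinnedChain ω₂ lam β γ).bondCurrent N ⟨0, Nat.zero_lt_of_lt hN⟩ y := fun y => by
    rw [OscillatorChain.bondCurrent_neg_momentum]; ring
  have hee : ∀ y : PhaseSpace N, ((y.1, -y.2).2 ⟨0, Nat.zero_lt_of_lt hN⟩) ^ 2 / 2 +
      (pinnedChain ω₂ lam β γ).U ((y.1, -y.2).1 ⟨0, Nat.zero_lt_of_lt hN⟩) +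
      (pinnedChain ω₂ lam β γ).V ((y.1, -y.2).1 ⟨1, hN⟩ - (y.1, -y.2).1 ⟨0, Nat.zero_lt_of_lt hN⟩) / 2 =
      1 * ((y.2 ⟨0, Nat.zero_lt_of_lt hN⟩) ^ 2 / 2 + (pinnedChain ω₂ lam β γ).U (y.1 ⟨0, Nat.zero_lt_of_lt hN⟩) +
        (pinnedChain ω₂ lam β γ).V (y.1 ⟨1, hN⟩ - y.1 ⟨0, Nat.zero_lt_of_lt hN⟩) / 2) := fun y => by
    simp only [Pi.neg_apply, neg_sq, one_mul]
  have hφe : ∀ y : PhaseSpace N, γ * (T - ((y.1, -y.2).2 ⟨0, Nat.zero_lt_of_lt hN⟩) ^ 2) =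
      1 * (γ * (T - (y.2 ⟨0, Nat.zero_lt_of_lt hN⟩) ^ 2)) := fun y => by
    simp only [Pi.neg_apply, neg_sq, one_mul]
  have hdyn := stub_siteEnergyDynkin ω₂ lam β γ hω hl hβ hγ T hT N hN
  have h := pinnedChain_heatProxy_sq_eq hω hl hβ hγ hN hT hjm hem hφm hj2 he2 hφ2 hjo hee hφe hdyn ht
  rw [h, spair_siteEnergy_deficit_eq hω hl hβ hγ hN hT, intervalIntegral.integral_congr
    (fun r _ => by rw [kpair_bathDrift_eq hN r]), bathHeatVar]
  have hc : ∫ r in (0 : ℝ)..t, (t - r) * (γ ^ 2 * bathKinCorr ω₂ lam β γ T N r) =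
      γ ^ 2 * ∫ r in (0 : ℝ)..t, (t - r) * bathKinCorr ω₂ lam β γ T N r := by
    rw [← intervalIntegral.integral_const_mul]
    exact intervalIntegral.integral_congr fun r _ => by ring
  rw [hc]
  ring

/-- ★ **Free rung (the KDN positivity) `W_N(t) ≥ 0`**, i.e. `γ² ∫₀ᵗ (t − r) K_N(r) dr ≤ γT²·t` for all `t ≥ 0`, `N ≥ 2` — a
second moment is nonnegative.  (The bath-bond line's `bathBondReduction_conditional` is the shadow of this on `E[(∫₀ᵗ j₀)²]`.)
[folklore] -/
theorem bathHeatVar_nonneg {t : ℝ} (ht : 0 ≤ t) : 0 ≤ bathHeatVar ω₂ lam β γ T N t := by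
  rw [← pinnedChain_bathHeat_sq_eq hω hl hβ hγ hN hT ht]
  exact integral_nonneg fun p => sq_nonneg _

end BathSide

end Summit.AtomisticToContinuum.FouriersLaw.Theorems.BoundedResponse.HeatSpreading

end
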